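import Mathlib
import Summits.Ventures.PercRepro.TriangleCapRowA1Arith

/-!
# PercRepro — THE ROW `r = a + 1`: THE ARITHMETIC OF THE DELETION READS FOR EVERY `a ≥ 5` (p3, gen 47; part 200ze)

The eight arithmetic lemmas of part 200u (`a ≥ 8`) and part 200z (`a ≥ 6`) re-proved with `a = q + 5`: all of them
hold for every `a ≥ 5`. Slacks (`a = q + 5`, `k = 3a + 1 + c`, `d = a − 1 − e`): `B2` cells
`2e (8 + c − e + 2q) − 8 − 2c − 4q ≥ 16`, the `T` cell `2 + 2q`, the cells `r = a − 1` and `r = a` exact, the mixed read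
`2 (e − 1)(q + 3 − e)`, the non-star read exact, the star reads `4` and `2s (3 + c − s + 2q) + 6 + 2c + 4q`.
Axioms: standard.
-/

namespace PercRepro

namespace TriangleCap

namespace C047

open Finset

/-- `d ≤ a − 4`: `D − z` on the `B2` cell `(k − 1, a, d + 1)`. -/
theorem rowA1_del_B2'' (a d k m' S' T : ℕ) (ha : 5 ≤ a) (hda : d + 4 ≤ a) (hk : 3 * a + 1 ≤ k)
    (hmd : m' + d + (a + 1) = a * (k - a))
    (hgap : S' + (d + 1) * (k - 1 - 1 - (d + 1)) + 2 * (k - 1 - 2 * a - 1) * (a - (d + 1)) ≤ m' * (k - 1))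
    (hT : T ≤ d * (k - a - 2)) :
    S' + 2 * T + d + d * d + (a + 1) * (k - 1 - (a + 1)) + (2 * k - 10) ≤ (m' + d) * k := by
  obtain ⟨q, rfl⟩ : ∃ q, a = q + 5 := ⟨a - 5, by omega⟩
  obtain ⟨e, he⟩ : ∃ e, d + e = q + 4 := ⟨q + 4 - d, by omega⟩
  have he3 : 3 ≤ e := by omega
  obtain ⟨c, rfl⟩ : ∃ c, k = 3 * (q + 5) + 1 + c := ⟨k - (3 * (q + 5) + 1), by omega⟩
  have e1 : 3 * (q + 5) + 1 + c - 1 - 1 - (d + 1) = 2 * q + 9 + c + e := by omega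
  have e2 : 3 * (q + 5) + 1 + c - 1 - 2 * (q + 5) - 1 = q + 4 + c := by omega
  have e3 : q + 5 - (d + 1) = e := by omega
  have e4 : 3 * (q + 5) + 1 + c - 1 = 3 * q + 15 + c := by omega
  have e5 : 3 * (q + 5) + 1 + c - (q + 5) - 2 = 2 * q + 9 + c := by omega
  have e6 : 3 * (q + 5) + 1 + c - 1 - (q + 5 + 1) = 2 * q + 9 + c := by omega
  have e7 : 2 * (3 * (q + 5) + 1 + c) - 10 = 6 * q + 22 + 2 * c := by omega
  have e8 : 3 * (q + 5) + 1 + c - (q + 5) = 2 * q + 11 + c := by omega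
  rw [e1, e2, e3, e4] at hgap
  rw [e5] at hT
  rw [e6, e7]
  rw [e8] at hmd
  obtain ⟨f, rfl⟩ : ∃ f, e = f + 3 := ⟨e - 3, by omega⟩
  have hf : f ≤ q + 1 := by omega
  have hff : f * f ≤ f * (q + 1) := Nat.mul_le_mul_left f hf
  nlinarith [hgap, hT, hmd, hff, he]

/-- `d = a − 3`: `D − z` on the `T` cell `(k − 1, a, a − 2)`: slack `8 + 2q`. -/
theorem rowA1_del_T'' (a k m' S' T : ℕ) (ha : 5 ≤ a) (hk : 3 * a + 1 ≤ k) (hmd : m' + (a - 3) + (a + 1) = a * (k - a))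
    (hgap : S' + (a - 2) * (k - 1 - 1 - (a - 2)) + 2 * (k - 1 - 2 * a - 1) ≤ m' * (k - 1))
    (hT : T ≤ (a - 3) * (k - a - 2)) :
    S' + 2 * T + (a - 3) + (a - 3) * (a - 3) + (a + 1) * (k - 1 - (a + 1)) + (2 * k - 10) ≤ (m' + (a - 3)) * k := by
  obtain ⟨q, rfl⟩ : ∃ q, a = q + 5 := ⟨a - 5, by omega⟩
  obtain ⟨c, rfl⟩ : ∃ c, k = 3 * (q + 5) + 1 + c := ⟨k - (3 * (q + 5) + 1), by omega⟩
  have e0 : q + 5 - 3 = q + 2 := by omega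
  have e0' : q + 5 - 2 = q + 3 := by omega
  have e1 : 3 * (q + 5) + 1 + c - 1 - 1 - (q + 3) = 2 * q + 11 + c := by omega
  have e2 : 3 * (q + 5) + 1 + c - 1 - 2 * (q + 5) - 1 = q + 4 + c := by omega
  have e4 : 3 * (q + 5) + 1 + c - 1 = 3 * q + 15 + c := by omega
  have e5 : 3 * (q + 5) + 1 + c - (q + 5) - 2 = 2 * q + 9 + c := by omega
  have e6 : 3 * (q + 5) + 1 + c - 1 - (q + 5 + 1) = 2 * q + 9 + c := by omega
  have e7 : 2 * (3 * (q + 5) + 1 + c) - 10 = 6 * q + 22 + 2 * c := by omega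
  have e8 : 3 * (q + 5) + 1 + c - (q + 5) = 2 * q + 11 + c := by omega
  rw [e0] at hmd hT ⊢
  rw [e0', e1, e2, e4] at hgap
  rw [e5] at hT
  rw [e6, e7]
  rw [e8] at hmd
  nlinarith [hgap, hT, hmd]

/-- `d = a − 2`: `D − z` on the `B2` cell `(k − 1, a, a − 1)`: exact. -/
theorem rowA1_del_B'' (a k m' S' T : ℕ) (ha : 5 ≤ a) (hk : 3 * a + 1 ≤ k) (hmd : m' + (a - 2) + (a + 1) = a * (k - a))
    (hgap : S' + (a - 1) * (k - 1 - 1 - (a - 1)) + 2 * (k - 1 - 2 * a - 1) ≤ m' * (k - 1))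
    (hT : T ≤ (a - 2) * (k - a - 2)) :
    S' + 2 * T + (a - 2) + (a - 2) * (a - 2) + (a + 1) * (k - 1 - (a + 1)) + (2 * k - 10) ≤ (m' + (a - 2)) * k := by
  obtain ⟨q, rfl⟩ : ∃ q, a = q + 5 := ⟨a - 5, by omega⟩
  obtain ⟨c, rfl⟩ : ∃ c, k = 3 * (q + 5) + 1 + c := ⟨k - (3 * (q + 5) + 1), by omega⟩
  have e0 : q + 5 - 2 = q + 3 := by omega
  have e0' : q + 5 - 1 = q + 4 := by omega
  have e1 : 3 * (q + 5) + 1 + c - 1 - 1 - (q + 4) = 2 * q + 10 + c := by omega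
  have e2 : 3 * (q + 5) + 1 + c - 1 - 2 * (q + 5) - 1 = q + 4 + c := by omega
  have e4 : 3 * (q + 5) + 1 + c - 1 = 3 * q + 15 + c := by omega
  have e5 : 3 * (q + 5) + 1 + c - (q + 5) - 2 = 2 * q + 9 + c := by omega
  have e6 : 3 * (q + 5) + 1 + c - 1 - (q + 5 + 1) = 2 * q + 9 + c := by omega
  have e7 : 2 * (3 * (q + 5) + 1 + c) - 10 = 6 * q + 22 + 2 * c := by omega
  have e8 : 3 * (q + 5) + 1 + c - (q + 5) = 2 * q + 11 + c := by omega
  rw [e0] at hmd hT ⊢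
  rw [e0', e1, e2, e4] at hgap
  rw [e5] at hT
  rw [e6, e7]
  rw [e8] at hmd
  nlinarith [hgap, hT, hmd]

/-- `d = a − 1`: `D − z` on the cell `(k − 1, a, a)` at its gap `2 (k − 1 − a − 3)`: exact. -/
theorem rowA1_del_A'' (a k m' S' T : ℕ) (ha : 5 ≤ a) (hk : 3 * a + 1 ≤ k) (hmd : m' + (a - 1) + (a + 1) = a * (k - a))
    (hgap : S' + a * (k - 1 - 1 - a) + 2 * (k - 1 - a - 3) ≤ m' * (k - 1))
    (hT : T ≤ (a - 1) * (k - a - 2)) :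
    S' + 2 * T + (a - 1) + (a - 1) * (a - 1) + (a + 1) * (k - 1 - (a + 1)) + (2 * k - 10) ≤ (m' + (a - 1)) * k := by
  obtain ⟨q, rfl⟩ : ∃ q, a = q + 5 := ⟨a - 5, by omega⟩
  obtain ⟨c, rfl⟩ : ∃ c, k = 3 * (q + 5) + 1 + c := ⟨k - (3 * (q + 5) + 1), by omega⟩
  have e0 : q + 5 - 1 = q + 4 := by omega
  have e1 : 3 * (q + 5) + 1 + c - 1 - 1 - (q + 5) = 2 * q + 9 + c := by omega
  have e2 : 3 * (q + 5) + 1 + c - 1 - (q + 5) - 3 = 2 * q + 7 + c := by omega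
  have e4 : 3 * (q + 5) + 1 + c - 1 = 3 * q + 15 + c := by omega
  have e5 : 3 * (q + 5) + 1 + c - (q + 5) - 2 = 2 * q + 9 + c := by omega
  have e6 : 3 * (q + 5) + 1 + c - 1 - (q + 5 + 1) = 2 * q + 9 + c := by omega
  have e7 : 2 * (3 * (q + 5) + 1 + c) - 10 = 6 * q + 22 + 2 * c := by omega
  have e8 : 3 * (q + 5) + 1 + c - (q + 5) = 2 * q + 11 + c := by omega
  rw [e0] at hmd hT ⊢
  rw [e1, e2, e4] at hgap
  rw [e5] at hT
  rw [e6, e7]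
  rw [e8] at hmd
  nlinarith [hgap, hT, hmd]

/-- The mixed read, `2 ≤ d ≤ a − 2`, `D − z` `a`-bipartite on `(k − 1, a, d + 1)`: slack `2 (e − 1)(q + 3 − e)`. -/
theorem rowA1_mixed'' (a d k m' S' T : ℕ) (ha : 5 ≤ a) (hd2 : 2 ≤ d) (hda : d + 2 ≤ a) (hk : 3 * a + 1 ≤ k)
    (hmd : m' + d + (a + 1) = a * (k - a)) (hS' : S' + (d + 1) * (k - 1 - 1 - (d + 1)) ≤ m' * (k - 1))
    (hT : T + (k - a - 2) ≤ d * (k - a - 2) + a) :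
    S' + 2 * T + d + d * d + (a + 1) * (k - 1 - (a + 1)) + (2 * k - 10) ≤ (m' + d) * k := by
  obtain ⟨q, rfl⟩ : ∃ q, a = q + 5 := ⟨a - 5, by omega⟩
  obtain ⟨e, he⟩ : ∃ e, d + e = q + 4 := ⟨q + 4 - d, by omega⟩
  have he1 : 1 ≤ e := by omega
  have he6 : e ≤ q + 3 := by omega
  obtain ⟨c, rfl⟩ : ∃ c, k = 3 * (q + 5) + 1 + c := ⟨k - (3 * (q + 5) + 1), by omega⟩
  have e1 : 3 * (q + 5) + 1 + c - 1 - 1 - (d + 1) = 2 * q + 9 + c + e := by omega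
  have e4 : 3 * (q + 5) + 1 + c - 1 = 3 * q + 15 + c := by omega
  have e5 : 3 * (q + 5) + 1 + c - (q + 5) - 2 = 2 * q + 9 + c := by omega
  have e6 : 3 * (q + 5) + 1 + c - 1 - (q + 5 + 1) = 2 * q + 9 + c := by omega
  have e7 : 2 * (3 * (q + 5) + 1 + c) - 10 = 6 * q + 22 + 2 * c := by omega
  have e8 : 3 * (q + 5) + 1 + c - (q + 5) = 2 * q + 11 + c := by omega
  rw [e1, e4] at hS'
  rw [e5] at hT
  rw [e6, e7]
  rw [e8] at hmd
  have h1 : (e - 1) * e ≤ (e - 1) * (q + 3) := Nat.mul_le_mul_left _ he6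
  have h2 : e - 1 + 1 = e := Nat.sub_add_cancel he1
  obtain ⟨x, hx⟩ : ∃ x, x = e - 1 := ⟨_, rfl⟩
  rw [← hx] at h1 h2
  clear hd2 hda hk ha
  nlinarith [hS', hT, hmd, h1, h2, he]

/-- `d = a − 1`, the non-star read: `D − z` `a`-bipartite on `(k − 1, a, a)` with no missing star, so `2 (a − 2)`
below its closed form; the mixed bound `T + (k − a − 2) ≤ (a − 1)(k − a − 2) + a`: exact. -/
theorem rowA1_last_nonstar'' (a k m' S' T : ℕ) (ha : 5 ≤ a) (hk : 3 * a + 1 ≤ k)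
    (hmd : m' + (a - 1) + (a + 1) = a * (k - a))
    (hS' : S' + a * (k - 1 - 1 - a) + 2 * (a - 2) ≤ m' * (k - 1))
    (hT : T + (k - a - 2) ≤ (a - 1) * (k - a - 2) + a) :
    S' + 2 * T + (a - 1) + (a - 1) * (a - 1) + (a + 1) * (k - 1 - (a + 1)) + (2 * k - 10) ≤ (m' + (a - 1)) * k := by
  obtain ⟨q, rfl⟩ : ∃ q, a = q + 5 := ⟨a - 5, by omega⟩
  obtain ⟨c, rfl⟩ : ∃ c, k = 3 * (q + 5) + 1 + c := ⟨k - (3 * (q + 5) + 1), by omega⟩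
  have e0 : q + 5 - 1 = q + 4 := by omega
  have e0' : q + 5 - 2 = q + 3 := by omega
  have e1 : 3 * (q + 5) + 1 + c - 1 - 1 - (q + 5) = 2 * q + 9 + c := by omega
  have e4 : 3 * (q + 5) + 1 + c - 1 = 3 * q + 15 + c := by omega
  have e5 : 3 * (q + 5) + 1 + c - (q + 5) - 2 = 2 * q + 9 + c := by omega
  have e6 : 3 * (q + 5) + 1 + c - 1 - (q + 5 + 1) = 2 * q + 9 + c := by omega
  have e7 : 2 * (3 * (q + 5) + 1 + c) - 10 = 6 * q + 22 + 2 * c := by omega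
  have e8 : 3 * (q + 5) + 1 + c - (q + 5) = 2 * q + 11 + c := by omega
  rw [e0] at hmd hT ⊢
  rw [e0', e1, e4] at hS'
  rw [e5] at hT
  rw [e6, e7]
  rw [e8] at hmd
  nlinarith [hS', hT, hmd]

/-- `d = a − 1`, the star read with the single off-side neighbour isolated in `D − z`: `S′ ≤ closed`,
`T ≤ (a − 2)(k − a − 2)`: slack `4`. -/
theorem rowA1_last_star0'' (a k m' S' T : ℕ) (ha : 5 ≤ a) (hk : 3 * a + 1 ≤ k)
    (hmd : m' + (a - 1) + (a + 1) = a * (k - a)) (hS' : S' + a * (k - 1 - 1 - a) ≤ m' * (k - 1))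
    (hT : T ≤ (a - 2) * (k - a - 2)) :
    S' + 2 * T + (a - 1) + (a - 1) * (a - 1) + (a + 1) * (k - 1 - (a + 1)) + (2 * k - 10) ≤ (m' + (a - 1)) * k := by
  obtain ⟨q, rfl⟩ : ∃ q, a = q + 5 := ⟨a - 5, by omega⟩
  obtain ⟨c, rfl⟩ : ∃ c, k = 3 * (q + 5) + 1 + c := ⟨k - (3 * (q + 5) + 1), by omega⟩
  have e0 : q + 5 - 1 = q + 4 := by omega
  have e0' : q + 5 - 2 = q + 3 := by omega
  have e1 : 3 * (q + 5) + 1 + c - 1 - 1 - (q + 5) = 2 * q + 9 + c := by omega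
  have e4 : 3 * (q + 5) + 1 + c - 1 = 3 * q + 15 + c := by omega
  have e5 : 3 * (q + 5) + 1 + c - (q + 5) - 2 = 2 * q + 9 + c := by omega
  have e6 : 3 * (q + 5) + 1 + c - 1 - (q + 5 + 1) = 2 * q + 9 + c := by omega
  have e7 : 2 * (3 * (q + 5) + 1 + c) - 10 = 6 * q + 22 + 2 * c := by omega
  have e8 : 3 * (q + 5) + 1 + c - (q + 5) = 2 * q + 11 + c := by omega
  rw [e0] at hmd ⊢
  rw [e0'] at hT
  rw [e1, e4] at hS'
  rw [e5] at hT
  rw [e6, e7]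
  rw [e8] at hmd
  nlinarith [hS', hT, hmd]

/-- `d = a − 1`, the star read with `s₀ ≥ 2` off-side neighbours, each of degree `≤ a + 1 − t`, `t = a − 1 − s₀`
in-side neighbours at `≤ k − a − 2`: `S′ ≤ closed`, `T ≤ t (k − a − 2) + s₀ (a + 1 − t)`:
slack `2s (9 + c − s + 2q) + 18 + 2c + 4q` (`s₀ = s + 2`). -/
theorem rowA1_last_star_ref'' (a t s₀ k m' S' T : ℕ) (ha : 5 ≤ a) (hk : 3 * a + 1 ≤ k) (hts : t + s₀ + 1 = a)
    (hs₀ : 2 ≤ s₀) (ht1 : 1 ≤ t) (hmd : m' + (a - 1) + (a + 1) = a * (k - a))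
    (hS' : S' + a * (k - 1 - 1 - a) ≤ m' * (k - 1)) (hT : T ≤ t * (k - a - 2) + s₀ * (a + 1 - t)) :
    S' + 2 * T + (a - 1) + (a - 1) * (a - 1) + (a + 1) * (k - 1 - (a + 1)) + (2 * k - 10) ≤ (m' + (a - 1)) * k := by
  obtain ⟨q, rfl⟩ : ∃ q, a = q + 5 := ⟨a - 5, by omega⟩
  obtain ⟨s, rfl⟩ : ∃ s, s₀ = s + 2 := ⟨s₀ - 2, by omega⟩
  obtain rfl : t = q + 2 - s := by omega
  have hs : s ≤ q + 1 := by omega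
  obtain ⟨c, rfl⟩ : ∃ c, k = 3 * (q + 5) + 1 + c := ⟨k - (3 * (q + 5) + 1), by omega⟩
  have e0 : q + 5 - 1 = q + 4 := by omega
  have e1 : 3 * (q + 5) + 1 + c - 1 - 1 - (q + 5) = 2 * q + 9 + c := by omega
  have e4 : 3 * (q + 5) + 1 + c - 1 = 3 * q + 15 + c := by omega
  have e5 : 3 * (q + 5) + 1 + c - (q + 5) - 2 = 2 * q + 9 + c := by omega
  have e6 : 3 * (q + 5) + 1 + c - 1 - (q + 5 + 1) = 2 * q + 9 + c := by omega
  have e7 : 2 * (3 * (q + 5) + 1 + c) - 10 = 6 * q + 22 + 2 * c := by omega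
  have e8 : 3 * (q + 5) + 1 + c - (q + 5) = 2 * q + 11 + c := by omega
  have e9 : q + 5 + 1 - (q + 2 - s) = s + 4 := by omega
  rw [e0] at hmd ⊢
  rw [e1, e4] at hS'
  rw [e5, e9] at hT
  rw [e6, e7]
  rw [e8] at hmd
  obtain ⟨t, ht⟩ : ∃ t, t = q + 2 - s := ⟨_, rfl⟩
  rw [← ht] at hT
  have ht' : t + s = q + 2 := by omega
  have hss : s * s ≤ s * (q + 1) := Nat.mul_le_mul_left s hs
  nlinarith [hS', hT, hmd, hss, ht']

end C047

end TriangleCap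

end PercRepro
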